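import Literature.NumberTheory.CubicFields.LocalDensityCount
import Mathlib.Data.ZMod.Units
import Mathlib.Data.Real.Basic
import Mathlib.Tactic.FieldSimp
import HarnessLib

/-!
# BST Lemma 13 at odd `p`: `#{f ∈ V(ℤ/p²ℤ) : p² ∣ Disc f} = p⁴(2p² − 1)`, so `μ(𝒱_p) = (1 − p⁻²)²`

`Proofs`-style file (theorems only). Topic `Literature/NumberTheory/CubicFields`; continues
`LocalDensityCount.lean` (`card_multipleRoot_eq_mul`: the forms mod `q` with a multiple root mod `p`
and an `SL₂(ℤ)`-invariant property `C` number `(p + 1)·#{a ≡ b ≡ 0 (mod p), C}`).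

Bhargava–Shankar–Tsimerman 2013, Lemma 13: `μ(𝒱_p) = (p² − 1)²/p⁴`, where (§4, following [DH])
`𝒱_p` is the set of forms maximal at `p` and not totally ramified at `p`; in the description used by the
tree's sieve (`ThreeTorsionSumFirstOrderSieve.lean`, Bhargava–Varma §3) `𝒱_p = {f : Disc f is
fundamental at p}`, which at an odd prime reads `p² ∤ Disc f` (`IsFundAt`, `LocalFundamental.lean`).
This file PROVES the density in that form, by the printed mechanism (proof of Lemmas 11–12: move the
multiple root to `(1, 0)`, then read the proportion off the coefficients): over `A = ℤ/p²ℤ` with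
`a ≡ b ≡ 0 (mod p)` one has `Disc ≡ −4ac³`, so `p² ∣ Disc` iff `p ∣ c` or `a ≡ 0 (mod p²)`.
* `natCard_box`, `natCard_split` — bookkeeping (`#` of a coordinate box in `V(R) ≃ R⁴`, splitting a count);
* arithmetic of `ℤ/p²ℤ`: `castHom_eq_zero_iff` (`x ≡ 0 (mod p)` iff `p ∣ x.val`), `mul_eq_zero_of_castHom`
  (two multiples of `p` multiply to `0`), `isUnit_of_castHom_ne_zero`, `natCard_castHom_eq_zero = p`;
* `disc_eq_of_castHom_ab` (`Disc = −4ac³` on the fibre), `disc_eq_zero_iff_of_castHom_ab`;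
* `natCard_fibre_disc_eq_zero = 2p⁴(p − 1)`, `natCard_map_eq_zero = p⁴`;
* **`natCard_disc_eq_zero_zmod_sq`**: `#{f ∈ V(ℤ/p²ℤ) : Disc f = 0} = p⁴(2p² − 1)`;
* **`natCard_disc_ne_zero_zmod_sq`**: `#{f ∈ V(ℤ/p²ℤ) : Disc f ≠ 0} = (p²(p² − 1))²`, i.e. the density
  of `{p² ∤ Disc}` is `(p²(p²−1))²/p⁸ = (1 − p⁻²)²` (`density_disc_ne_zero_zmod_sq`).

## References

* M. Bhargava, A. Shankar, J. Tsimerman, *On the Davenport–Heilbronn theorems and second order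
  terms*, Invent. Math. 193 (2013) 439–499 = arXiv:1005.0672, Lemmas 11–13 [BhargavaShankarTsimerman2012].
* H. Davenport, H. Heilbronn, *On the density of discriminants of cubic fields. II*, Proc. Roy.
  Soc. London A 322 (1971) 405–420, §4 [DavenportHeilbronn1971].
-/

namespace Literature.NumberTheory.CubicFields

namespace BinaryCubic

open Finset

/-! ### Bookkeeping: boxes and splits -/

section Book

variable {R : Type*}

/-- A coordinate box in `V(R) ≃ R⁴` has cardinality the product of its sides. [folklore] -/
theorem natCard_box (P₁ P₂ P₃ P₄ : R → Prop) :
    Nat.card {f : BinaryCubic R // P₁ f.a ∧ P₂ f.b ∧ P₃ f.c ∧ P₄ f.d} =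
      Nat.card {x // P₁ x} * (Nat.card {x // P₂ x} * (Nat.card {x // P₃ x} * Nat.card {x // P₄ x})) := by
  rw [← Nat.card_prod, ← Nat.card_prod, ← Nat.card_prod]
  refine Nat.card_congr
    { toFun := fun f => (⟨f.1.a, f.2.1⟩, ⟨f.1.b, f.2.2.1⟩, ⟨f.1.c, f.2.2.2.1⟩, ⟨f.1.d, f.2.2.2.2⟩)
      invFun := fun v => ⟨⟨v.1.1, v.2.1.1, v.2.2.1.1, v.2.2.2.1⟩, v.1.2, v.2.1.2, v.2.2.1.2, v.2.2.2.2⟩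
      left_inv := fun ⟨⟨_, _, _, _⟩, _⟩ => rfl
      right_inv := fun ⟨⟨_, _⟩, ⟨_, _⟩, ⟨_, _⟩, ⟨_, _⟩⟩ => rfl }

/-- Splitting a finite count along a second predicate. [folklore] -/
theorem natCard_split {α : Type*} [Finite α] (P Q : α → Prop) :
    Nat.card {x // P x} = Nat.card {x // P x ∧ Q x} + Nat.card {x // P x ∧ ¬ Q x} := by
  classical
  have := Fintype.ofFinite α
  rw [Nat.card_eq_fintype_card, Nat.card_eq_fintype_card, Nat.card_eq_fintype_card, Fintype.card_subtype,
    Fintype.card_subtype, Fintype.card_subtype, ← card_filter_add_card_filter_not (p := Q),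
    filter_filter, filter_filter]

/-- Counting along an equivalent predicate. [folklore] -/
theorem natCard_congr_prop {α : Type*} {P Q : α → Prop} (h : ∀ x, P x ↔ Q x) :
    Nat.card {x // P x} = Nat.card {x // Q x} :=
  Nat.card_congr (Equiv.subtypeEquivRight h)

end Book

/-! ### Arithmetic of `ℤ/p²ℤ` -/

section PSq

variable {p : ℕ} [hp : Fact p.Prime]

/-- `p ∣ p²`. [folklore] -/
theorem dvd_sq_self (p : ℕ) : p ∣ p ^ 2 := dvd_pow_self p two_ne_zero

/-- `x ≡ 0 (mod p)` iff `p ∣ x.val`, for `x ∈ ℤ/p²ℤ`. [folklore] -/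
theorem castHom_eq_zero_iff (x : ZMod (p ^ 2)) : ZMod.castHom (dvd_sq_self p) (ZMod p) x = 0 ↔ p ∣ x.val := by
  rw [ZMod.castHom_apply, ZMod.cast_eq_val, ZMod.natCast_eq_zero_iff]

/-- A multiple of `p` in `ℤ/p²ℤ` is `p·k` with `k < p`. [folklore] -/
theorem exists_eq_p_mul {x : ZMod (p ^ 2)} (h : ZMod.castHom (dvd_sq_self p) (ZMod p) x = 0) :
    ∃ k : ℕ, k < p ∧ x = ((p * k : ℕ) : ZMod (p ^ 2)) := by
  obtain ⟨k, hk⟩ := (castHom_eq_zero_iff x).mp h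
  refine ⟨k, ?_, by rw [← hk, ZMod.natCast_zmod_val]⟩
  have := ZMod.val_lt x
  rw [hk, sq] at this
  exact Nat.lt_of_mul_lt_mul_left this

/-- Two multiples of `p` multiply to `0` in `ℤ/p²ℤ`. [folklore] -/
theorem mul_eq_zero_of_castHom {x y : ZMod (p ^ 2)} (hx : ZMod.castHom (dvd_sq_self p) (ZMod p) x = 0)
    (hy : ZMod.castHom (dvd_sq_self p) (ZMod p) y = 0) : x * y = 0 := by
  obtain ⟨k, -, rfl⟩ := exists_eq_p_mul hx
  obtain ⟨l, -, rfl⟩ := exists_eq_p_mul hy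
  rw [← Nat.cast_mul, show p * k * (p * l) = p ^ 2 * (k * l) by ring, Nat.cast_mul, ZMod.natCast_self, zero_mul]

/-- An element `≢ 0 (mod p)` is a unit of `ℤ/p²ℤ`. [folklore] -/
theorem isUnit_of_castHom_ne_zero {u : ZMod (p ^ 2)} (hu : ZMod.castHom (dvd_sq_self p) (ZMod p) u ≠ 0) : IsUnit u := by
  rw [Ne, castHom_eq_zero_iff] at hu
  have hcop : u.val.Coprime (p ^ 2) :=
    (Nat.coprime_pow_right_iff two_pos _ _).mpr (Nat.coprime_comm.mp (hp.out.coprime_iff_not_dvd.mpr hu))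
  have := (ZMod.isUnit_iff_coprime u.val (p ^ 2)).mpr hcop
  rwa [ZMod.natCast_zmod_val] at this

/-- `4` is a unit of `ℤ/p²ℤ` for odd `p`. [folklore] -/
theorem isUnit_four (hp2 : p ≠ 2) : IsUnit (4 : ZMod (p ^ 2)) := by
  have h : Nat.Coprime 4 (p ^ 2) := by
    have h2 : Nat.Coprime 2 p := (Nat.coprime_primes Nat.prime_two hp.out).mpr (Ne.symm hp2)
    simpa using Nat.Coprime.pow 2 2 h2
  have := (ZMod.isUnit_iff_coprime 4 (p ^ 2)).mpr h
  simpa using this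

/-- **`#{x ∈ ℤ/p²ℤ : x ≡ 0 (mod p)} = p`** (the multiples `p·k`, `k < p`). [folklore] -/
theorem natCard_castHom_eq_zero : Nat.card {x : ZMod (p ^ 2) // ZMod.castHom (dvd_sq_self p) (ZMod p) x = 0} = p := by
  set g : Fin p → ZMod (p ^ 2) := fun i => ((p * i : ℕ) : ZMod (p ^ 2)) with hg
  have hlt : ∀ i : Fin p, p * i < p ^ 2 := fun i => by rw [sq]; exact (Nat.mul_lt_mul_left hp.out.pos).mpr i.2
  have hval : ∀ i : Fin p, (g i).val = p * i := fun i => by rw [hg, ZMod.val_natCast, Nat.mod_eq_of_lt (hlt i)]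
  have hinj : Function.Injective g := fun i j hij => by
    have := congrArg ZMod.val hij
    rw [hval, hval] at this
    exact Fin.ext (Nat.eq_of_mul_eq_mul_left hp.out.pos this)
  have h : ∀ x : ZMod (p ^ 2), ZMod.castHom (dvd_sq_self p) (ZMod p) x = 0 ↔ x ∈ Set.range g := by
    intro x
    constructor
    · intro hx
      obtain ⟨k, hk, rfl⟩ := exists_eq_p_mul hx
      exact ⟨⟨k, hk⟩, rfl⟩
    · rintro ⟨i, rfl⟩
      rw [castHom_eq_zero_iff, hval]
      exact dvd_mul_right p i
  rw [natCard_congr_prop h]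
  change Nat.card (Set.range g) = p
  rw [Nat.card_range_of_injective hinj, Nat.card_eq_fintype_card, Fintype.card_fin]

/-- `#{x ∈ ℤ/p²ℤ : x ≢ 0 (mod p)} = p² − p`. [folklore] -/
theorem natCard_castHom_ne_zero : Nat.card {x : ZMod (p ^ 2) // ¬ ZMod.castHom (dvd_sq_self p) (ZMod p) x = 0} = p ^ 2 - p := by
  classical
  rw [Nat.card_eq_fintype_card, Fintype.card_subtype_compl, ZMod.card, ← Nat.card_eq_fintype_card,
    natCard_castHom_eq_zero]

omit hp in
/-- `#{x ∈ ℤ/p²ℤ : x = 0} = 1`. [folklore] -/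
theorem natCard_eq_zero_zmod : Nat.card {x : ZMod (p ^ 2) // x = 0} = 1 := by
  rw [Nat.card_eq_fintype_card, Fintype.card_unique]

omit hp in
/-- `#{x ∈ ℤ/p²ℤ : True} = p²`. [folklore] -/
theorem natCard_true_zmod : Nat.card {_x : ZMod (p ^ 2) // True} = p ^ 2 := by
  rw [Nat.card_congr (Equiv.subtypeUnivEquiv fun _ => trivial), Nat.card_zmod]

/-! ### The discriminant on the fibre `a ≡ b ≡ 0 (mod p)` -/

/-- **`Disc ≡ −4ac³ (mod p²)` when `a ≡ b ≡ 0 (mod p)`** (all other monomials contain two factors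
from `{a, b}`). [cite: BhargavaShankarTsimerman2012, proof of Lemma 12 (the normal form a ≡ b ≡ 0 (mod p))] -/
theorem disc_eq_of_castHom_ab {f : BinaryCubic (ZMod (p ^ 2))} (ha : ZMod.castHom (dvd_sq_self p) (ZMod p) f.a = 0)
    (hb : ZMod.castHom (dvd_sq_self p) (ZMod p) f.b = 0) : f.disc = -4 * (f.a * f.c ^ 3) := by
  have hbb := mul_eq_zero_of_castHom hb hb
  have hab := mul_eq_zero_of_castHom ha hb
  have haa := mul_eq_zero_of_castHom ha ha
  rw [disc_eq]
  calc f.b ^ 2 * f.c ^ 2 - 4 * f.a * f.c ^ 3 - 4 * f.b ^ 3 * f.d - 27 * f.a ^ 2 * f.d ^ 2 + 18 * f.a * f.b * f.c * f.d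
      = (f.b * f.b) * f.c ^ 2 - 4 * f.a * f.c ^ 3 - 4 * ((f.b * f.b) * f.b) * f.d - 27 * (f.a * f.a) * f.d ^ 2
        + 18 * (f.a * f.b) * f.c * f.d := by ring
    _ = -4 * (f.a * f.c ^ 3) := by rw [hbb, hab, haa]; ring

/-- On the fibre `a ≡ b ≡ 0 (mod p)`, odd `p`: **`p² ∣ Disc` iff `p ∣ c` or `a ≡ 0 (mod p²)`**. [cite: BhargavaShankarTsimerman2012, proof of Lemma 12 ("a proportion of 1/p actually satisfy the congruence a ≡ 0 (mod p²)")] -/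
theorem disc_eq_zero_iff_of_castHom_ab (hp2 : p ≠ 2) {f : BinaryCubic (ZMod (p ^ 2))}
    (ha : ZMod.castHom (dvd_sq_self p) (ZMod p) f.a = 0) (hb : ZMod.castHom (dvd_sq_self p) (ZMod p) f.b = 0) :
    f.disc = 0 ↔ (ZMod.castHom (dvd_sq_self p) (ZMod p) f.c = 0 ∨ f.a = 0) := by
  rw [disc_eq_of_castHom_ab ha hb, ((isUnit_four hp2).neg).mul_right_eq_zero]
  by_cases hc : ZMod.castHom (dvd_sq_self p) (ZMod p) f.c = 0
  · simp only [hc, true_or, iff_true]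
    rw [show f.a * f.c ^ 3 = (f.a * f.c) * (f.c * f.c) by ring, mul_eq_zero_of_castHom ha hc, zero_mul]
  · simp only [hc, false_or]
    exact ((isUnit_of_castHom_ne_zero hc).pow 3).mul_left_eq_zero

/-- A form `≡ 0 (mod p)` has `Disc ≡ 0 (mod p²)` (indeed mod `p⁴`). [folklore] -/
theorem disc_eq_zero_of_map_eq_zero {f : BinaryCubic (ZMod (p ^ 2))} (h : f.map (ZMod.castHom (dvd_sq_self p) (ZMod p)) = 0) :
    f.disc = 0 := by
  rw [map_eq_zero_iff] at h
  rw [disc_eq_of_castHom_ab h.1 h.2.1, show f.a * f.c ^ 3 = (f.a * f.c) * (f.c * f.c) by ring,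
    mul_eq_zero_of_castHom h.1 h.2.2.1, zero_mul, mul_zero]

/-! ### The counts -/

/-- **The fibre count**: `#{f mod p² : f ≢ 0 (mod p), p² ∣ Disc f, a ≡ b ≡ 0 (mod p)} = 2p⁴(p − 1)`
(`p ∣ c, p ∤ d`: `p·p·p·(p² − p)` forms; `p ∤ c, a = 0`: `1·p·(p² − p)·p²` forms). [cite: BhargavaShankarTsimerman2012, proof of Lemma 12 (proportions on the normal form)] -/
theorem natCard_fibre_disc_eq_zero (hp2 : p ≠ 2) :
    Nat.card {f : BinaryCubic (ZMod (p ^ 2)) // f.map (ZMod.castHom (dvd_sq_self p) (ZMod p)) ≠ 0 ∧ f.disc = 0 ∧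
      (f.map (ZMod.castHom (dvd_sq_self p) (ZMod p))).a = 0 ∧ (f.map (ZMod.castHom (dvd_sq_self p) (ZMod p))).b = 0} =
      2 * p ^ 4 * (p - 1) := by
  set π := ZMod.castHom (dvd_sq_self p) (ZMod p) with hπ
  rw [natCard_split _ (fun f => π f.c = 0)]
  have h1 : ∀ f : BinaryCubic (ZMod (p ^ 2)), ((f.map π ≠ 0 ∧ f.disc = 0 ∧ (f.map π).a = 0 ∧ (f.map π).b = 0) ∧ π f.c = 0) ↔
      (π f.a = 0 ∧ π f.b = 0 ∧ π f.c = 0 ∧ ¬ π f.d = 0) := by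
    intro f
    simp only [ne_eq, map_eq_zero_iff, map_a, map_b]
    constructor
    · rintro ⟨⟨h0, -, ha, hb⟩, hc⟩
      exact ⟨ha, hb, hc, fun hd => h0 ⟨ha, hb, hc, hd⟩⟩
    · rintro ⟨ha, hb, hc, hd⟩
      exact ⟨⟨fun h => hd h.2.2.2, (disc_eq_zero_iff_of_castHom_ab hp2 ha hb).mpr (Or.inl hc), ha, hb⟩, hc⟩
  have h2 : ∀ f : BinaryCubic (ZMod (p ^ 2)), ((f.map π ≠ 0 ∧ f.disc = 0 ∧ (f.map π).a = 0 ∧ (f.map π).b = 0) ∧ ¬ π f.c = 0) ↔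
      (f.a = 0 ∧ π f.b = 0 ∧ ¬ π f.c = 0 ∧ True) := by
    intro f
    simp only [ne_eq, map_eq_zero_iff, map_a, map_b, and_true]
    constructor
    · rintro ⟨⟨-, hD, ha, hb⟩, hc⟩
      exact ⟨((disc_eq_zero_iff_of_castHom_ab hp2 ha hb).mp hD).resolve_left hc, hb, hc⟩
    · rintro ⟨ha, hb, hc⟩
      have ha' : π f.a = 0 := by rw [ha, map_zero]
      exact ⟨⟨fun h => hc h.2.2.1, (disc_eq_zero_iff_of_castHom_ab hp2 ha' hb).mpr (Or.inr ha), ha', hb⟩, hc⟩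
  rw [natCard_congr_prop h1, natCard_congr_prop h2,
    natCard_box (fun x => π x = 0) (fun x => π x = 0) (fun x => π x = 0) (fun x => ¬ π x = 0),
    natCard_box (fun x => x = 0) (fun x => π x = 0) (fun x => ¬ π x = 0) (fun _ => True),
    natCard_castHom_eq_zero, natCard_castHom_ne_zero, natCard_eq_zero_zmod, natCard_true_zmod]
  have hp1 : 1 ≤ p := hp.out.one_lt.le
  zify [hp1, Nat.le_self_pow two_ne_zero p]
  ring

/-- `#{f mod p² : f ≡ 0 (mod p)} = p⁴`. [folklore] -/
theorem natCard_map_eq_zero :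
    Nat.card {f : BinaryCubic (ZMod (p ^ 2)) // f.map (ZMod.castHom (dvd_sq_self p) (ZMod p)) = 0} = p ^ 4 := by
  set π := ZMod.castHom (dvd_sq_self p) (ZMod p)
  rw [natCard_congr_prop (fun f => map_eq_zero_iff π f),
    natCard_box (fun x => π x = 0) (fun x => π x = 0) (fun x => π x = 0) (fun x => π x = 0), natCard_castHom_eq_zero]
  ring

/-- **BST Lemma 13 at odd `p`, as a count mod `p²`**: `#{f ∈ V(ℤ/p²ℤ) : Disc f = 0} = p⁴(2p² − 1)`
(`p⁴` forms `≡ 0 (mod p)`, plus `(p + 1)·2p⁴(p − 1)` forms with a multiple root mod `p` and `p² ∣ Disc`).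
[cite: BhargavaShankarTsimerman2012, Lemma 13 (μ(𝒱_p) = (p²−1)²/p⁴)] -/
theorem natCard_disc_eq_zero_zmod_sq (hp2 : p ≠ 2) :
    Nat.card {f : BinaryCubic (ZMod (p ^ 2)) // f.disc = 0} = p ^ 4 * (2 * p ^ 2 - 1) := by
  set π := ZMod.castHom (dvd_sq_self p) (ZMod p) with hπ
  rw [natCard_split _ (fun f => f.map π = 0)]
  have h1 : ∀ f : BinaryCubic (ZMod (p ^ 2)), (f.disc = 0 ∧ f.map π = 0) ↔ f.map π = 0 :=
    fun f => ⟨fun h => h.2, fun h => ⟨disc_eq_zero_of_map_eq_zero h, h⟩⟩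
  have h2 : ∀ f : BinaryCubic (ZMod (p ^ 2)), (f.disc = 0 ∧ ¬ f.map π = 0) ↔
      (f.map π ≠ 0 ∧ (f.map π).disc = 0 ∧ f.disc = 0) :=
    fun f => ⟨fun h => ⟨h.2, by rw [disc_map, h.1, map_zero], h.1⟩, fun h => ⟨h.2.2, h.1⟩⟩
  have hC : ∀ γ : Matrix (Fin 2) (Fin 2) ℤ, γ.det = 1 → ∀ f : BinaryCubic (ZMod (p ^ 2)),
      (f.subst (γ.map (Int.castRingHom (ZMod (p ^ 2))))).disc = 0 ↔ f.disc = 0 := fun γ hγ f => by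
    rw [disc_subst_of_det_eq_one f (det_map_eq_one hγ)]
  rw [natCard_congr_prop h1, natCard_congr_prop h2, natCard_map_eq_zero,
    card_multipleRoot_eq_mul hp.out (dvd_sq_self p) (fun f => f.disc = 0) hC, natCard_fibre_disc_eq_zero hp2]
  have hp1 : 1 ≤ p := hp.out.one_lt.le
  have hp1' : 1 ≤ 2 * p ^ 2 := by nlinarith
  zify [hp1, hp1']
  ring

/-- **The local density at odd `p`**: `#{f ∈ V(ℤ/p²ℤ) : p² ∤ Disc f} = (p²(p² − 1))² = p⁸ · (1 − p⁻²)²`.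
[cite: BhargavaShankarTsimerman2012, Lemma 13 (μ(𝒱_p) = (p²−1)²/p⁴)] -/
theorem natCard_disc_ne_zero_zmod_sq (hp2 : p ≠ 2) :
    Nat.card {f : BinaryCubic (ZMod (p ^ 2)) // f.disc ≠ 0} = (p ^ 2 * (p ^ 2 - 1)) ^ 2 := by
  classical
  rw [Nat.card_eq_fintype_card, Fintype.card_subtype_compl, card_eq, ZMod.card, ← Nat.card_eq_fintype_card,
    natCard_disc_eq_zero_zmod_sq hp2]
  have hp1 : 1 ≤ p ^ 2 := Nat.one_le_pow _ _ hp.out.pos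
  have hp1' : 1 ≤ 2 * p ^ 2 := by linarith
  have hp2' : 2 ≤ p ^ 2 := le_trans hp.out.two_le (Nat.le_self_pow two_ne_zero p)
  have hle : p ^ 4 * (2 * p ^ 2 - 1) ≤ (p ^ 2) ^ 4 := by
    have h : 2 * p ^ 2 - 1 ≤ p ^ 4 := by
      have h1 : 2 * p ^ 2 ≤ p ^ 2 * p ^ 2 := Nat.mul_le_mul_right _ hp2'
      have e : p ^ 2 * p ^ 2 = p ^ 4 := by ring
      omega
    calc p ^ 4 * (2 * p ^ 2 - 1) ≤ p ^ 4 * p ^ 4 := Nat.mul_le_mul_left _ h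
      _ = (p ^ 2) ^ 4 := by ring
  zify [hp1, hp1', hle]
  ring

/-- The same as a density: `#{f ∈ V(ℤ/p²ℤ) : p² ∤ Disc f} / p⁸ = (1 − p⁻²)²`. [cite: BhargavaShankarTsimerman2012, Lemma 13] -/
theorem density_disc_ne_zero_zmod_sq (hp2 : p ≠ 2) :
    (Nat.card {f : BinaryCubic (ZMod (p ^ 2)) // f.disc ≠ 0} : ℝ) / ((p : ℝ) ^ 2) ^ 4 = (1 - 1 / (p : ℝ) ^ 2) ^ 2 := by
  rw [natCard_disc_ne_zero_zmod_sq hp2]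
  have hp0 : (p : ℝ) ≠ 0 := Nat.cast_ne_zero.mpr hp.out.ne_zero
  have hp1 : 1 ≤ p ^ 2 := Nat.one_le_pow _ _ hp.out.pos
  push_cast [Nat.cast_sub hp1]
  field_simp

end PSq

end BinaryCubic

end Literature.NumberTheory.CubicFields
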